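import Summits.CriticalPhenomena.PercolationContinuityZ3.Theorems.PercNearOneGluingNoHeavyConstsTwoSourceBHKCore
import HarnessLib

/-!
# van den Berg–Häggström–Kahn's Theorem 1.1 with TWO SOURCES: the four-functions hypothesis holds in the source
# lattice as well — measure form and corollaries   (PAPER-2 track (ii); seat `prim-consts-2`, gen 15)

builds on p205010 (kernel theorem, internal audit signed; external expert review pending).  Support file
(`--supports stmt-CriticalPhenomena-4575`); memo `run/shared/lean/prim/consts/FROM-prim-consts-2-g15-TWO-SOURCE.md`.
Theorems only; no sorries; standard axioms.  The induction (sum form) is `Consts.TwoSource.core₂` in the companion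
file `…ConstsTwoSourceBHKCore.lean`.

* `Consts.twoSource_twoSet` — **THEOREM (two-source two-set BHK).**  For every finite weighted graph
  (`μ = prodBernoulli w`), source sets `S, S'`, repelled sets `X, Y` and increasing `F, G ≥ 0` read on the union
  clusters `C_A = ⋃_{a∈A} C_a`:
  `(∫_{S↮X} F(C_S)) · (∫_{S'↮Y} G(C_{S'})) ≤ (∫_{S∪S'↮X∩Y} F G(C_{S∪S'})) · μ(S∩S' ↮ X∪Y)`,
  `{A ↮ W} = {∀ a ∈ A, ∀ x ∈ W, a ↮ x}`.  At `S = S'` it is BHK's Theorem 1.1 with a source set (tree: `BHK2006.core`,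
  `BHK2006_setClusterConditionalPositiveAssociation`).
* `Consts.twoSource_sameTarget` — `X = Y = T`: **the source four-functions inequality**
  `(∫_{S↮T} F(C_S))(∫_{S'↮T} G(C_{S'})) ≤ (∫_{S∪S'↮T} F G(C_{S∪S'})) · μ(S∩S'↮T)`, i.e. the Ahlswede–Daykin
  HYPOTHESIS for the family `S ↦ ∫_{S↮T} F(C_S) dμ` on the lattice of source sets — so four-functions / FKG arguments
  over a RANDOM source set with a log-supermodular law independent of the configuration (e.g. the open star of an
  avoided set `X` after peeling `X`: the "polarised form" situation of memo FROM-prim-consts-2-g14-DUAL-HNU.md §0(6)) are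
  available on the source side exactly as BHK use them on the repelled side.
* `Consts.avoid_mul_avoid_le_sourceLattice` — `F = G = 1`: `μ(S↮X) μ(S'↮Y) ≤ μ(S∪S'↮X∩Y) μ(S∩S'↮X∪Y)`.
* `Consts.avoid_kernel_nonneg` — `s ∈ S`: `μ(s↮x) μ(S↮{x}∪T') ≤ μ(S↮x) μ(s↮{x}∪T')`, i.e. `P(S↮T' | S↮x) ≤ P(s↮T' | s↮x)`
  — the sign of the two-source kernel `g_S(t)` of memo FROM-prim-consts-2-g10-VERTEX-INDUCTION.md, for every `t`.
Exact numerical census of the two-source two-set inequality (seat engines `work/ab/master.py`, `sad2.py`, `sad.py`: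
random weights in {1/2,1/3,2/3,1/8,7/8,1/32,31/32}, all graphs n ≤ 5 with m ≤ 8 (and n = 6, m ≤ 9), |S|,|S'|,|X|,|Y| ≤ 3,
`F` from a menu and `G` over ALL increasing 0/1 functions by exact max-closure): 0 violations in > 16 000 (instance, F)
pairs; the variant with the sources oriented like the repelled sets (`S∩S'` with `X∩Y`) fails.
Not in print in this form; derived here.
[cite: VandenbergHaggstromKahn2005, Thm. 1.1 (pp. 3–5), Remark 1 after Thm. 1.2 (p. 5), Thm. 1.3 (p. 6)]
-/

noncomputable section

namespace Summit.CriticalPhenomena.PercolationContinuityZ3.Theorems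

open MeasureTheory Set Literature.Probability.LatticeModels Literature.Probability.Percolation
open Literature.Probability.Percolation.BHK2006 DecisionTree
open scoped Classical

namespace Consts

open TwoSource

variable {V : Type*} [Fintype V]

/-- **THEOREM (two-source two-set BHK, measure form).**  For every finite weighted graph (`μ = prodBernoulli w`),
source sets `S, S'`, repelled sets `X, Y`, and increasing `F, G ≥ 0` (functions of edge sets, read on the union
clusters `C_A = ⋃_{a∈A} C_a`):
`(∫_{S↮X} F(C_S) dμ) · (∫_{S'↮Y} G(C_{S'}) dμ) ≤ (∫_{S∪S' ↮ X∩Y} F(C_{S∪S'}) G(C_{S∪S'}) dμ) · μ(S∩S' ↮ X∪Y)`,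
where `{A ↮ W} = {ω | ∀ a ∈ A, ∀ x ∈ W, ¬ a ↔ x}`.  The sources enter with the lattice orientation OPPOSITE to the
repelled sets (union with the intersection, intersection with the union).  `S = S'` is BHK's Theorem 1.1 with a
source set; `X = Y` is `Consts.twoSource_sameTarget`.
[cite: VandenbergHaggstromKahn2005, Thm. 1.1 (pp. 3–5) and Remark 1 after Thm. 1.2 (p. 5) — two-source form derived here] -/
theorem twoSource_twoSet (w : Sym2 V → unitInterval) (S S' X Y : Set V) (F G : Set (Sym2 V) → ℝ)
    (hF : Monotone F) (hG : Monotone G) (hF0 : ∀ C, 0 ≤ F C) (hG0 : ∀ C, 0 ≤ G C) :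
    (∫ ω in {ω : BondConfig V | ∀ s ∈ S, ∀ x ∈ X, ¬ (openGraph ω).Reachable s x},
        F (⋃ s ∈ S, openEdgeCluster ω s) ∂(prodBernoulli w)) *
      (∫ ω in {ω : BondConfig V | ∀ s ∈ S', ∀ x ∈ Y, ¬ (openGraph ω).Reachable s x},
        G (⋃ s ∈ S', openEdgeCluster ω s) ∂(prodBernoulli w)) ≤
    (∫ ω in {ω : BondConfig V | ∀ s ∈ S ∪ S', ∀ x ∈ X ∩ Y, ¬ (openGraph ω).Reachable s x},
        F (⋃ s ∈ S ∪ S', openEdgeCluster ω s) * G (⋃ s ∈ S ∪ S', openEdgeCluster ω s)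
          ∂(prodBernoulli w)) *
      (prodBernoulli w).real {ω : BondConfig V | ∀ s ∈ S ∩ S', ∀ x ∈ X ∪ Y,
        ¬ (openGraph ω).Reachable s x} := by
  classical
  set w' : Sym2 V → ℝ := fun e => (w e : ℝ) with hw'
  have hw0 : ∀ e, 0 ≤ w' e := fun e => (w e).2.1
  have hw1 : ∀ e, w' e ≤ 1 := fun e => (w e).2.2
  -- set integrals and masses as finite sums
  have hint : ∀ (D : Set (BondConfig V)) (h : Set (Sym2 V) → ℝ),
      ∫ ω in D, h ω ∂(prodBernoulli w) = ∑ ω, weight w' ω * (h ω * ind D ω) := by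
    intro D h
    rw [← integral_indicator (MeasurableSet.of_discrete : MeasurableSet D), integral_prodBernoulli_eq_sum]
    refine Finset.sum_congr rfl fun ω _ => ?_
    by_cases hω : ω ∈ D
    · rw [Set.indicator_of_mem hω, ind_of_mem hω, mul_one]
    · rw [Set.indicator_of_notMem hω, ind_of_not_mem hω]; ring
  have hreal : ∀ D : Set (BondConfig V), (prodBernoulli w).real D = ∑ ω, weight w' ω * ind D ω := by
    intro D
    rw [← integral_indicator_one (MeasurableSet.of_discrete : MeasurableSet D),
      integral_prodBernoulli_eq_sum]
    refine Finset.sum_congr rfl fun ω _ => ?_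
    by_cases hω : ω ∈ D
    · rw [Set.indicator_of_mem hω, ind_of_mem hω, Pi.one_apply]
    · rw [Set.indicator_of_notMem hω, ind_of_not_mem hω, mul_zero]
  have hm : ∑ ω, weight w' ω = 1 := by
    have h1 := integral_prodBernoulli_eq_sum w fun _ => (1 : ℝ)
    simp only [integral_const, probReal_univ, smul_eq_mul, mul_one] at h1
    exact h1.symm
  -- `U = univ`: the restricted quantities are the original ones
  have hE : ∀ ω : Set (Sym2 V), ω ∩ BHK2006.edgesIn (Finset.univ : Finset V) = ω := fun ω => by
    ext e
    simp only [Set.mem_inter_iff, BHK2006.edgesIn, Set.mem_setOf_eq, Finset.mem_univ, imp_true_iff,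
      and_true]
  have hC : ∀ (A : Set V) (ω : Set (Sym2 V)), rCS Finset.univ A ω = ⋃ s ∈ A, openEdgeCluster ω s :=
    fun A ω => by simp only [rCS, rC, hE]
  have hDD : ∀ (A W : Set V), rDS Finset.univ A W =
      {ω : BondConfig V | ∀ s ∈ A, ∀ x ∈ W, ¬ (openGraph ω).Reachable s x} := fun A W => by
    ext ω
    simp only [rDS, hE, Set.mem_setOf_eq]
  have hsub : ∀ A : Set V, A ⊆ ↑(Finset.univ : Finset V) := fun A => by simp
  have key := core₂ w' hw0 hw1 hm Finset.univ S S' (hsub S) (hsub S') X Y (hsub X) (hsub Y)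
    F G hF hG hF0 hG0
  simp only [hC, hDD] at key
  rw [hint, hint, hint, hreal]
  exact key

/-- **COROLLARY (the source four-functions inequality, one repelled set).**  For `X = Y = T`:
`(∫_{S↮T} F(C_S))(∫_{S'↮T} G(C_{S'})) ≤ (∫_{S∪S'↮T} F G(C_{S∪S'})) · μ(S∩S' ↮ T)` — the Ahlswede–Daykin
hypothesis for the family `S ↦ ∫_{S ↮ T} F(C_S) dμ` on the lattice of source sets (so, for a random source set with a
log-supermodular law independent of the configuration, the averaged quantities satisfy the four functions theorem's
conclusion).  [cite: VandenbergHaggstromKahn2005, Thm. 1.1 (pp. 3–5), Thm. 1.3 (p. 6) — derived here] -/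
theorem twoSource_sameTarget (w : Sym2 V → unitInterval) (S S' T : Set V) (F G : Set (Sym2 V) → ℝ)
    (hF : Monotone F) (hG : Monotone G) (hF0 : ∀ C, 0 ≤ F C) (hG0 : ∀ C, 0 ≤ G C) :
    (∫ ω in {ω : BondConfig V | ∀ s ∈ S, ∀ x ∈ T, ¬ (openGraph ω).Reachable s x},
        F (⋃ s ∈ S, openEdgeCluster ω s) ∂(prodBernoulli w)) *
      (∫ ω in {ω : BondConfig V | ∀ s ∈ S', ∀ x ∈ T, ¬ (openGraph ω).Reachable s x},
        G (⋃ s ∈ S', openEdgeCluster ω s) ∂(prodBernoulli w)) ≤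
    (∫ ω in {ω : BondConfig V | ∀ s ∈ S ∪ S', ∀ x ∈ T, ¬ (openGraph ω).Reachable s x},
        F (⋃ s ∈ S ∪ S', openEdgeCluster ω s) * G (⋃ s ∈ S ∪ S', openEdgeCluster ω s)
          ∂(prodBernoulli w)) *
      (prodBernoulli w).real {ω : BondConfig V | ∀ s ∈ S ∩ S', ∀ x ∈ T,
        ¬ (openGraph ω).Reachable s x} := by
  have h := twoSource_twoSet w S S' T T F G hF hG hF0 hG0
  rwa [Set.inter_self, Set.union_self] at h

/-- **COROLLARY (`F = G = 1`): avoidance probabilities are jointly log-supermodular in (source, repelled set) with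
opposite orientations**: `μ(S↮X) μ(S'↮Y) ≤ μ(S∪S' ↮ X∩Y) μ(S∩S' ↮ X∪Y)`.
[cite: VandenbergHaggstromKahn2005, Thm. 1.1 (pp. 3–5) — derived here] -/
theorem avoid_mul_avoid_le_sourceLattice (w : Sym2 V → unitInterval) (S S' X Y : Set V) :
    (prodBernoulli w).real {ω : BondConfig V | ∀ s ∈ S, ∀ x ∈ X, ¬ (openGraph ω).Reachable s x} *
      (prodBernoulli w).real {ω : BondConfig V | ∀ s ∈ S', ∀ x ∈ Y, ¬ (openGraph ω).Reachable s x} ≤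
    (prodBernoulli w).real {ω : BondConfig V | ∀ s ∈ S ∪ S', ∀ x ∈ X ∩ Y, ¬ (openGraph ω).Reachable s x} *
      (prodBernoulli w).real {ω : BondConfig V | ∀ s ∈ S ∩ S', ∀ x ∈ X ∪ Y,
        ¬ (openGraph ω).Reachable s x} := by
  have h := twoSource_twoSet w S S' X Y (fun _ => 1) (fun _ => 1) monotone_const monotone_const
    (fun _ => zero_le_one) (fun _ => zero_le_one)
  simp only [mul_one] at h
  rw [setIntegral_const, setIntegral_const, setIntegral_const] at h
  simpa only [smul_eq_mul, mul_one, Measure.real] using h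

/-- **COROLLARY (positivity of the two-source avoidance kernel).**  For `s ∈ S` and any `x`, `T'`:
`μ(s ↮ x) · μ(S ↮ {x} ∪ T') ≤ μ(S ↮ x) · μ(s ↮ {x} ∪ T')`, i.e. `P(S ↮ T' | S ↮ x) ≤ P(s ↮ T' | s ↮ x)`: a larger
source, conditioned on avoiding `x`, is less likely to also avoid `T'` (the sign of the kernel `g_S(t)` of the
two-source inequality R(S) of memo FROM-prim-consts-2-g10-VERTEX-INDUCTION.md, for every `t`).
[cite: VandenbergHaggstromKahn2005, Thm. 1.1 (pp. 3–5) — derived here] -/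
theorem avoid_kernel_nonneg (w : Sym2 V → unitInterval) (S : Set V) {s : V} (hs : s ∈ S) (x : V)
    (T' : Set V) :
    (prodBernoulli w).real {ω : BondConfig V | ¬ (openGraph ω).Reachable s x} *
      (prodBernoulli w).real {ω : BondConfig V | ∀ s ∈ S, ∀ y ∈ insert x T', ¬ (openGraph ω).Reachable s y} ≤
    (prodBernoulli w).real {ω : BondConfig V | ∀ s ∈ S, ¬ (openGraph ω).Reachable s x} *
      (prodBernoulli w).real {ω : BondConfig V | ∀ y ∈ insert x T', ¬ (openGraph ω).Reachable s y} := by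
  have h := avoid_mul_avoid_le_sourceLattice w {s} S {x} (insert x T')
  have e1 : ({s} : Set V) ∪ S = S := by
    rw [Set.singleton_union]; exact Set.insert_eq_of_mem hs
  have e2 : ({s} : Set V) ∩ S = {s} := by
    rw [Set.inter_eq_left]; exact Set.singleton_subset_iff.2 hs
  have e3 : ({x} : Set V) ∩ insert x T' = {x} := by
    rw [Set.inter_eq_left]; exact Set.singleton_subset_iff.2 (Set.mem_insert x T')
  have e4 : ({x} : Set V) ∪ insert x T' = insert x T' := by
    rw [Set.union_eq_right]; exact Set.singleton_subset_iff.2 (Set.mem_insert x T')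
  rw [e1, e2, e3, e4] at h
  have f1 : {ω : BondConfig V | ∀ s' ∈ ({s} : Set V), ∀ y ∈ ({x} : Set V), ¬ (openGraph ω).Reachable s' y} =
      {ω : BondConfig V | ¬ (openGraph ω).Reachable s x} := by
    ext ω; simp
  have f2 : {ω : BondConfig V | ∀ s' ∈ S, ∀ y ∈ ({x} : Set V), ¬ (openGraph ω).Reachable s' y} =
      {ω : BondConfig V | ∀ s ∈ S, ¬ (openGraph ω).Reachable s x} := by
    ext ω; simp
  have f3 : {ω : BondConfig V | ∀ s' ∈ ({s} : Set V), ∀ y ∈ insert x T', ¬ (openGraph ω).Reachable s' y} =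
      {ω : BondConfig V | ∀ y ∈ insert x T', ¬ (openGraph ω).Reachable s y} := by
    ext ω; simp
  rw [f1, f2, f3] at h
  exact h

end Consts

end Summit.CriticalPhenomena.PercolationContinuityZ3.Theorems

end
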